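import Summits.QuantumFields.BalabanUV.T4Continuum.Support.ShellMeasureLogConcaveJacobianSUN
import Summits.QuantumFields.BalabanUV.T4Continuum.Support.ShellMeasureRootCompositionSUN

/-!
# `T4Continuum.ShellMeasureLogConcaveSUN` — member (λ) REALIZED for `G = SU(N)`, every `N`: Prékopa–Leindler and the
# (λ) engine transported to the block chart space `Λ → ℝ^{d_N}`, the a.e. Jacobian swap, and the realized headline with
# (C-ii) on the block weight alone — the `SU(N)` twin of `ShellMeasureLogConcaveJacobian` §3 / `ShellMeasureLogConcaveSU2` §1
# (cell `pub-balaban`, sub-cell `t4`, spine estimate NE7c (node U5b); ROUND-2 crew `t4-ne7c-formalise-*`, seat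
# `b2b-balaban-t4-ne7c-formalise-leaf-04` (gen 3); c5-optional `SU(N)` orbit of row S3 «SM-L9 SU(N) chart» / S39 (journal
# OFFER l.12876); ADDITIVE — imports `ShellMeasureLogConcaveJacobianSUN` (S39 f2: the windowed `SU(N)` chart Jacobian is a
# log-concave weight) and `ShellMeasureRootCompositionSUN` (E2N: realized (M1) from chart-level (M1), (CH)₁ a theorem) only
# and modifies nothing; 0 `def`, 0 sorry, 0 citations, no `def … : Prop`)

HONEST FRAMING.  Finite four-torus programme, rung (B)+1 only — NOT infinite volume, NOT a mass gap, NOT the Clay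
problem, NOT summit progress.  Nothing of [Balaban 1983–89] is asserted; everything is [folklore] kernel bookkeeping over
the tree's Prékopa–Leindler theorem (`Literature.Analysis.Convexity.prekopaLeindler_pi`, Brascamp–Lieb 1976 Thm 3.3, BY
NAME) and tree theorems BY NAME.  The cell wall of NE7c — (M1) FOR BAŁABAN'S INDUCTIVELY DEFINED EFFECTIVE MEASURES at
live levels ⇐ SM-L1/SM-L4/SM-L6 + node U1b's rate — is NOT PRINTED (GAPS G-ne7cp1-1) and NOT moved; member (λ)
(`ShellMeasureLogConcave`, lineage P1 gen 24) rests on the located DESIGN reading (λ-1) «convex classifiers» (dead for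
B14 (2.17) as printed) — a census member, NOT of record; `SU(2)` is row S3's certified instance (trigger c5); NOTHING in
the countdown moves (spine PROVED 0/9); «NE7c ⇐ the named binders», never «NE7c proved».  HONEST DEPENDENCY (cell,
verbatim): continuum YM on T⁴ ⇐ BetaPertH ∧ nine spine estimates (0/9 proved); BetaPertH ⇐ (D1) ∧ (D4) ∧ CAP+tail;
G-an2-4 gates asym, D1 and NE2/3/4.

THE POINTS (all [folklore]).
* §1 TRANSPORT.  If `μ = Φ_* Lebesgue(ℝⁿ)` for a LINEAR measurable `Φ : ℝⁿ → E` (`MeasurePreserving Φ volume μ`), then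
  Prékopa–Leindler holds for `μ` (`prekopaLeindler_of_measurePreserving`), hence (λ)'s grounding and chart-side headline
  (`logConcaveSublevelOn_of_logConcave_of_measurePreserving`, `slotAntiConcentration_of_logConcave_of_measurePreserving`) —
  `ShellMeasureLogConcave` §2 verbatim with `ℝⁿ` replaced by `(E, μ)`.
* §2 THE BLOCK CHART SPACE `BlockChartSU N Λ = Λ → EuclideanSpace ℝ (Fin d_N)` IS SO PARAMETRISED: flat coordinates along
  an enumeration `Λ × Fin d_N ≃ Fin n` are linear and measure preserving (`measurePreserving_flatCoords`: Mathlib's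
  `volume_measurePreserving_piCongrLeft`, the tree's `LatticeMaxwell.volume_preserving_curry`, bondwise
  `PiLp.volume_preserving_toLp`; `exists_linear_measurePreserving`) ⟹ `prekopaLeindler_blockChartSU`,
  `logConcaveSublevelOn_of_logConcave_blockChartSU`, **`slotAntiConcentration_of_logConcave_blockChartSU`** (D = 2P).
* §3 THE A.E. JACOBIAN SWAP.  The `SU(N)` road's chart weight of record `1_{‖x‖≤S}·∏_b κ_N·expJacSU(x_b)` (E2N, CH f9/f10;
  `expJacSU` vanishes on the non-regular cone, so it is NOT log-concave as a function) equals `volume`-a.e. the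
  continuous representative `1_{‖x‖≤S}·∏_b κ_N·J(x_b)`, `J = jacM = det T_v` (`chartWeightSU_expJac_ae_eq`, from
  `ShellMeasureExpHaarAreaSUN.jacM_ae_eq_expJacSU` bond by bond); the tilted chart LAWS coincide
  (`withDensity_chartWeightSU_expJac_eq`).
* §4 **`slotAntiConcentration_realized_suN_of_logConcave_blockWeight`** (+ `_gauge` through the tree gauge): for
  `(fieldMeasure P j SU(N)).withDensity F` with the window factorisation `F(V[Λ := y]) = windowSU Λ (c V) S y · R V y`,
  `0 ≤ S ≤ π`, per-section finiteness, and per exterior `V` (C-ii) the windowed block weight ALONE `1_{‖x‖≤S}·R V∘κ`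
  log-concave (the Jacobian rides free by `ShellMeasureLogConcaveJacobianSUN.isLogConcaveWeight_chartWeightSU_smul_jacM`),
  (C-i) the sectioned classifier convex on its support, (C-iii) the half-threshold mass ratio `e^P` ⟹ (M1)
  `SlotAntiConcentration ((fieldMeasure P j SU(N)).withDensity F) u θ ρ (2P)` — E2N `slotAC_realized_suN_of_chartAC` ∘ §3 ∘ §2.
  So member (λ) RUNS end to end on the `SU(N)` road, every `N`, exactly as `ShellMeasureLogConcaveJacobian` §3 runs it
  for `SU(2)`.

WHAT THIS DOES NOT DO.  No instance of (C-i)/(C-ii)/(C-iii) for Bałaban's sectioned block weights or classifiers is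
constructed (for the verbatim classifier of B14 (2.17) (C-i) FAILS — `ShellMeasureLogConcaveSU2` §2–§3); no SM-L binder
is re-sourced or removed; (Det), (FI-sat), (LR), (MR), (W1), the (F∞)-rate keep their status.  NE7c NOT proved.
-/

noncomputable section

namespace Summit.QuantumFields.BalabanUV.T4Continuum.ShellMeasureLogConcaveSUN

open MeasureTheory Set Function Metric
open scoped ENNReal
open Literature.MathematicalPhysics.QuantumFieldTheory.Balaban1983to89
open T4ShellMeasure (SlotAntiConcentration)
open ShellMeasureLogConcave (IsLogConcaveWeight ConvexOnSupport LogConcaveSublevelOn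
  slotAntiConcentration_of_logConcaveSublevel isLogConcaveWeight_mul)
open ShellMeasureExpChartSUN (ChartSU BlockChartSU dimSU chartWeightSU expFibreChartSU SUN)

/-! ## §1 Prékopa–Leindler and the (λ) engine along a LINEAR measure-preserving parametrisation -/

section Transport

variable {E : Type*} [AddCommGroup E] [Module ℝ E] [MeasurableSpace E] {μ : Measure E} {n : ℕ}

/-- **PRÉKOPA–LEINDLER TRANSPORTED.**  If `μ` on a real vector space `E` is the image of Lebesgue measure on `ℝⁿ` under a
LINEAR measurable `Φ` (`MeasurePreserving Φ volume μ`), then Prékopa–Leindler holds for `μ`: for measurable `f, g, h : E → [0,∞]`,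
`0 < s < 1`, `h((1−s)x + sy) ≥ f(x)^{1−s} g(y)^s` ⟹ `∫ h dμ ≥ (∫ f dμ)^{1−s} (∫ g dμ)^s` (the tree's `prekopaLeindler_pi` for
`f ∘ Φ, g ∘ Φ, h ∘ Φ`; linearity of `Φ` carries the three-point hypothesis, `MeasurePreserving.lintegral_comp` the integrals). [folklore] -/
theorem prekopaLeindler_of_measurePreserving (Φ : (Fin n → ℝ) →ₗ[ℝ] E) (hΦ : MeasurePreserving Φ volume μ)
    {s : ℝ} (hs0 : 0 < s) (hs1 : s < 1) {f g h : E → ℝ≥0∞} (hf : Measurable f) (hg : Measurable g)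
    (hh : Measurable h) (H : ∀ x y, f x ^ (1 - s) * g y ^ s ≤ h ((1 - s) • x + s • y)) :
    (∫⁻ x, f x ∂μ) ^ (1 - s) * (∫⁻ y, g y ∂μ) ^ s ≤ ∫⁻ z, h z ∂μ := by
  rw [← hΦ.lintegral_comp hf, ← hΦ.lintegral_comp hg, ← hΦ.lintegral_comp hh]
  refine Literature.Analysis.Convexity.prekopaLeindler_pi hs0 hs1 n (f := fun x => f (Φ x))
    (g := fun x => g (Φ x)) (h := fun x => h (Φ x)) (hf.comp hΦ.measurable) (hg.comp hΦ.measurable)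
    (hh.comp hΦ.measurable) fun x y => ?_
  show f (Φ x) ^ (1 - s) * g (Φ y) ^ s ≤ h (Φ ((1 - s) • x + s • y))
  rw [map_add, map_smul, map_smul]
  exact H _ _

/-- **(λ)'S GROUNDING TRANSPORTED: LOG-CONCAVE WEIGHT × CONVEX CLASSIFIER ⇒ LOG-CONCAVE SUBLEVEL FUNCTION** under any
`μ = Φ_* Lebesgue`, `Φ` linear — `ShellMeasureLogConcave.logConcaveSublevelOn_of_logConcave` verbatim with
`prekopaLeindler_of_measurePreserving` in place of `prekopaLeindler_pi`. [folklore] -/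
theorem logConcaveSublevelOn_of_logConcave_of_measurePreserving (Φ : (Fin n → ℝ) →ₗ[ℝ] E)
    (hΦ : MeasurePreserving Φ volume μ) {w : E → ℝ≥0∞} (hw : Measurable w) (hlc : IsLogConcaveWeight w)
    {u : E → ℝ} (hu : Measurable u) (hconv : ConvexOnSupport w u) (r₀ θ : ℝ) :
    LogConcaveSublevelOn (μ.withDensity w) u r₀ θ := by
  intro a b s _ _ _ _ hs0 hs1
  have hms : ∀ c : ℝ, MeasurableSet {x : E | u x < c} := fun c => measurableSet_lt hu measurable_const
  have happly : ∀ c : ℝ, (μ.withDensity w) {x | u x < c} = ∫⁻ x, {x | u x < c}.indicator w x ∂μ := fun c => by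
    rw [withDensity_apply _ (hms c), lintegral_indicator (hms c)]
  rw [happly, happly, happly]
  refine prekopaLeindler_of_measurePreserving Φ hΦ hs0 hs1 (hw.indicator (hms a)) (hw.indicator (hms b))
    (hw.indicator (hms _)) fun x y => ?_
  have h1s : 0 < 1 - s := by linarith
  by_cases hx : u x < a
  · by_cases hy : u y < b
    · rw [indicator_of_mem (show x ∈ {x | u x < a} from hx), indicator_of_mem (show y ∈ {x | u x < b} from hy)]
      by_cases hwx : w x = 0
      · rw [hwx, ENNReal.zero_rpow_of_pos h1s, zero_mul]; exact bot_le
      by_cases hwy : w y = 0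
      · rw [hwy, ENNReal.zero_rpow_of_pos hs0, mul_zero]; exact bot_le
      have hz : (1 - s) • x + s • y ∈ {x | u x < (1 - s) * a + s * b} := by
        show u ((1 - s) • x + s • y) < (1 - s) * a + s * b
        calc u ((1 - s) • x + s • y) ≤ (1 - s) * u x + s * u y := hconv x y hwx hwy hs0 hs1
          _ < (1 - s) * a + s * b := by nlinarith [mul_lt_mul_of_pos_left hx h1s, mul_lt_mul_of_pos_left hy hs0]
      rw [indicator_of_mem hz]
      exact hlc x y hs0 hs1
    · rw [indicator_of_notMem (show y ∉ {x | u x < b} from hy), ENNReal.zero_rpow_of_pos hs0, mul_zero]; exact bot_le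
  · rw [indicator_of_notMem (show x ∉ {x | u x < a} from hx), ENNReal.zero_rpow_of_pos h1s, zero_mul]; exact bot_le

/-- **MEMBER (λ)'S CHART-SIDE HEADLINE TRANSPORTED** to any `μ = Φ_* Lebesgue`, `Φ` linear: a measurable LOG-CONCAVE weight
`w` of finite `μ`-mass (C-ii), a measurable classifier `u` CONVEX ON THE SUPPORT (C-i), `θ > 0`, `0 ≤ ρ ≤ 1/2`, and the
HALF-THRESHOLD MASS RATIO (C-iii) `mass ≤ e^P·(μ.withDensity w){u < θ/2}`, `P ≥ 0` ⟹ (M1) `SlotAntiConcentration (μ.withDensity w)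
u θ ρ (2P)` — `ShellMeasureLogConcave.slotAntiConcentration_of_logConcave` verbatim over the transported grounding. [folklore] -/
theorem slotAntiConcentration_of_logConcave_of_measurePreserving (Φ : (Fin n → ℝ) →ₗ[ℝ] E)
    (hΦ : MeasurePreserving Φ volume μ) {w : E → ℝ≥0∞} (hw : Measurable w) (hlc : IsLogConcaveWeight w)
    (hfin : (μ.withDensity w) univ ≠ ∞) {u : E → ℝ} (hu : Measurable u) (hconv : ConvexOnSupport w u)
    {θ ρ P : ℝ} (hθ : 0 < θ) (hρ0 : 0 ≤ ρ) (hρ : ρ ≤ 1 / 2) (hP : 0 ≤ P)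
    (hmass : (μ.withDensity w) univ ≤ ENNReal.ofReal (Real.exp P) * (μ.withDensity w) {x | u x < θ / 2}) :
    SlotAntiConcentration (μ.withDensity w) u θ ρ (2 * P) := by
  have h := slotAntiConcentration_of_logConcaveSublevel (μ.withDensity w) hfin hu (r₀ := θ / 2) hθ.le hρ0
    (by linarith) (by nlinarith) hP
    (logConcaveSublevelOn_of_logConcave_of_measurePreserving Φ hΦ hw hlc hu hconv (θ / 2) θ) hmass
  have hD : P * θ / (θ - θ / 2) = 2 * P := by field_simp; ring
  rwa [hD] at h

end Transport

/-! ## §2 The `SU(N)` block chart space `Λ → ℝ^{d_N}` is linearly parametrised by `ℝⁿ`, Lebesgue to Lebesgue -/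

section BlockChart

open Literature.MathematicalPhysics.QuantumFieldTheory.LatticeMaxwell (volume_preserving_curry)

variable {N : ℕ} {P : Params} {j : ℕ} (Λ : Finset (PBond P j)) {n : ℕ}

/-- FLAT COORDINATES OF THE BLOCK CHART ARE MEASURE PRESERVING: along an enumeration `e : Λ × Fin d_N ≃ Fin n`, the map
`u ↦ (b ↦ (u_{e(b,i)})_i)` from `ℝⁿ` (Lebesgue) to `BlockChartSU N Λ = Λ → EuclideanSpace ℝ (Fin d_N)` (product of the Euclidean
volumes) is measure preserving — Mathlib's `volume_measurePreserving_piCongrLeft`, the tree's `LatticeMaxwell.volume_preserving_curry`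
(as in `T4CubeChartGnomonic.measurePreserving_regroup` for `SU(2)`), bondwise `PiLp.volume_preserving_toLp`. [folklore] -/
theorem measurePreserving_flatCoords (e : ↥Λ × Fin (dimSU N) ≃ Fin n) :
    MeasurePreserving (fun (u : Fin n → ℝ) (b : ↥Λ) => (WithLp.toLp 2 fun i : Fin (dimSU N) => u (e (b, i)) : ChartSU N))
      volume volume := by
  -- relabel `Fin n → Λ × Fin d`
  have h1 : MeasurePreserving (fun (u : Fin n → ℝ) (q : ↥Λ × Fin (dimSU N)) => u (e q)) volume volume := by
    have h := (volume_measurePreserving_piCongrLeft (fun _ : Fin n => ℝ) e).symm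
      (MeasurableEquiv.piCongrLeft (fun _ : Fin n => ℝ) e)
    have hfun : (⇑((MeasurableEquiv.piCongrLeft (fun _ : Fin n => ℝ) e).symm) :
        (Fin n → ℝ) → (↥Λ × Fin (dimSU N) → ℝ)) = fun u q => u (e q) := by
      funext u q
      exact Equiv.piCongrLeft_symm_apply (P := fun _ : Fin n => ℝ) (e := e) u q
    rwa [hfun] at h
  -- curry `Λ × Fin d → ℝ` to `Λ → Fin d → ℝ`
  have h2 : MeasurePreserving (fun (g : ↥Λ × Fin (dimSU N) → ℝ) (b : ↥Λ) (i : Fin (dimSU N)) => g (b, i)) volume volume := by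
    have h := volume_preserving_curry ↥Λ (Fin (dimSU N)); rwa [MeasurableEquiv.coe_curry] at h
  -- pass to `EuclideanSpace` bondwise
  have h3 : MeasurePreserving (fun (a : ↥Λ → Fin (dimSU N) → ℝ) (b : ↥Λ) => (WithLp.toLp 2 (a b) : ChartSU N)) volume
      volume := volume_preserving_pi fun _ : ↥Λ => PiLp.volume_preserving_toLp (Fin (dimSU N))
  exact h3.comp (h2.comp h1)

/-- **THE BLOCK CHART SPACE IS LINEARLY PARAMETRISED BY `ℝⁿ`, LEBESGUE TO LEBESGUE**: there are `n` (`= #Λ·d_N`) and a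
LINEAR `Φ : ℝⁿ → BlockChartSU N Λ` with `MeasurePreserving Φ volume volume` — the hypothesis of §1. [folklore] -/
theorem exists_linear_measurePreserving :
    ∃ (n : ℕ) (Φ : (Fin n → ℝ) →ₗ[ℝ] BlockChartSU N Λ), MeasurePreserving Φ volume volume := by
  classical
  obtain ⟨e⟩ : Nonempty (↥Λ × Fin (dimSU N) ≃ Fin (Fintype.card (↥Λ × Fin (dimSU N)))) := ⟨Fintype.equivFin _⟩
  refine ⟨Fintype.card (↥Λ × Fin (dimSU N)),
    { toFun := fun u b => (WithLp.toLp 2 fun i : Fin (dimSU N) => u (e (b, i)) : ChartSU N)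
      map_add' := fun u v => ?_
      map_smul' := fun c u => ?_ }, measurePreserving_flatCoords Λ e⟩
  · funext b; rw [Pi.add_apply, ← WithLp.toLp_add]; rfl
  · funext b; rw [Pi.smul_apply, ← WithLp.toLp_smul]; rfl

/-- **PRÉKOPA–LEINDLER ON THE `SU(N)` BLOCK CHART SPACE** (`volume` = product of the Euclidean volumes). [folklore] -/
theorem prekopaLeindler_blockChartSU {s : ℝ} (hs0 : 0 < s) (hs1 : s < 1) {f g h : BlockChartSU N Λ → ℝ≥0∞}
    (hf : Measurable f) (hg : Measurable g) (hh : Measurable h) (H : ∀ x y, f x ^ (1 - s) * g y ^ s ≤ h ((1 - s) • x + s • y)) :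
    (∫⁻ x, f x) ^ (1 - s) * (∫⁻ y, g y) ^ s ≤ ∫⁻ z, h z := by
  obtain ⟨n, Φ, hΦ⟩ := exists_linear_measurePreserving (N := N) Λ
  exact prekopaLeindler_of_measurePreserving Φ hΦ hs0 hs1 hf hg hh H

/-- **(λ)'S GROUNDING ON THE `SU(N)` BLOCK CHART SPACE**: a measurable log-concave weight `w` and a measurable
classifier `u` convex on its support give a LOG-CONCAVE SUBLEVEL FUNCTION `r ↦ (vol.withDensity w){u < r}`
(`ShellMeasureLogConcave.logConcaveSublevelOn_of_logConcave` with `Fin n → ℝ` replaced by `BlockChartSU N Λ`). [folklore] -/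
theorem logConcaveSublevelOn_of_logConcave_blockChartSU {w : BlockChartSU N Λ → ℝ≥0∞} (hw : Measurable w)
    (hlc : IsLogConcaveWeight w) {u : BlockChartSU N Λ → ℝ} (hu : Measurable u) (hconv : ConvexOnSupport w u)
    (r₀ θ : ℝ) : LogConcaveSublevelOn ((volume : Measure (BlockChartSU N Λ)).withDensity w) u r₀ θ := by
  obtain ⟨n, Φ, hΦ⟩ := exists_linear_measurePreserving (N := N) Λ
  exact logConcaveSublevelOn_of_logConcave_of_measurePreserving Φ hΦ hw hlc hu hconv r₀ θ

/-- **MEMBER (λ) ON THE `SU(N)` BLOCK CHART SPACE — THE CHART-SIDE HEADLINE**: `ShellMeasureLogConcave.slotAntiConcentration_of_logConcave`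
with `Fin n → ℝ` replaced by `BlockChartSU N Λ`: (C-ii) `w` log-concave, measurable, of finite mass; (C-i) `u` convex on
the support of `w`; (C-iii) `mass ≤ e^P·(vol.withDensity w){u < θ/2}`; `θ > 0`, `0 ≤ ρ ≤ 1/2`, `P ≥ 0` ⟹
`SlotAntiConcentration (volume.withDensity w) u θ ρ (2P)`. [folklore] -/
theorem slotAntiConcentration_of_logConcave_blockChartSU {w : BlockChartSU N Λ → ℝ≥0∞} (hw : Measurable w)
    (hlc : IsLogConcaveWeight w) (hfin : ((volume : Measure (BlockChartSU N Λ)).withDensity w) univ ≠ ∞)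
    {u : BlockChartSU N Λ → ℝ} (hu : Measurable u) (hconv : ConvexOnSupport w u) {θ ρ P : ℝ} (hθ : 0 < θ)
    (hρ0 : 0 ≤ ρ) (hρ : ρ ≤ 1 / 2) (hP : 0 ≤ P)
    (hmass : ((volume : Measure (BlockChartSU N Λ)).withDensity w) univ ≤
      ENNReal.ofReal (Real.exp P) * ((volume : Measure (BlockChartSU N Λ)).withDensity w) {x | u x < θ / 2}) :
    SlotAntiConcentration ((volume : Measure (BlockChartSU N Λ)).withDensity w) u θ ρ (2 * P) := by
  obtain ⟨n, Φ, hΦ⟩ := exists_linear_measurePreserving (N := N) Λ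
  exact slotAntiConcentration_of_logConcave_of_measurePreserving Φ hΦ hw hlc hfin hu hconv hθ hρ0 hρ hP hmass

end BlockChart

/-! ## §3 The chart law with the CONTINUOUS Jacobian `κ_N·jacM` is the chart law of record (`expJacWeightSU κ_N`) -/

section Jacobian

open ShellMeasureExpJacobianSUN (expJacWeightSU)
open ShellMeasureExpHaarAreaSUN (jacM measurable_jacM jacM_ae_eq_expJacSU kappaSU)

variable {N : ℕ} [NeZero N] {P : Params} {j : ℕ} (Λ : Finset (PBond P j))

/-- almost every point of the block chart space has EVERY bond coordinate off the non-regular cone, so that there the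
weight of record `expJacWeightSU κ` equals `κ·jacM` bond by bond (`jacM_ae_eq_expJacSU` under each coordinate
projection, `Measure.tendsto_eval_ae_ae`; finitely many bonds). [folklore] -/
theorem ae_forall_expJacWeightSU_eq (κ : ℝ≥0∞) :
    ∀ᵐ x ∂(volume : Measure (BlockChartSU N Λ)), ∀ b : ↥Λ, expJacWeightSU κ (x b) = κ * jacM (x b) := by
  have h1 : ∀ᵐ v ∂(volume : Measure (ChartSU N)), expJacWeightSU κ v = κ * jacM v := by
    filter_upwards [jacM_ae_eq_expJacSU (N := N)] with v hv
    rw [expJacWeightSU, hv]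
  rw [ae_all_iff]; intro b; rw [volume_pi]
  exact (Measure.tendsto_eval_ae_ae (μ := fun _ : ↥Λ => (volume : Measure (ChartSU N))) (i := b)).eventually h1

/-- **THE TWO BLOCK CHART WEIGHTS AGREE ALMOST EVERYWHERE**: `1_{‖x‖≤S}·∏_b κ_N·expJacSU(x_b) = 1_{‖x‖≤S}·∏_b κ_N·J(x_b)`
for `volume`-a.e. `x` — the weight of record of the `SU(N)` road (E2N, CH f9/f10) versus the continuous, LOG-CONCAVE
representative of `ShellMeasureLogConcaveJacobianSUN`. [folklore] -/
theorem chartWeightSU_expJac_ae_eq (S : ℝ) :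
    chartWeightSU (N := N) Λ S (expJacWeightSU (kappaSU N)) =ᵐ[volume]
      chartWeightSU Λ S fun v => kappaSU N * jacM v := by
  filter_upwards [ae_forall_expJacWeightSU_eq Λ (kappaSU N)] with x hx
  unfold chartWeightSU
  by_cases hxS : x ∈ closedBall (0 : BlockChartSU N Λ) S
  · rw [indicator_of_mem hxS, indicator_of_mem hxS]
    exact Finset.prod_congr rfl fun b _ => hx b
  · rw [indicator_of_notMem hxS, indicator_of_notMem hxS]

/-- hence the chart LAWS tilted by any further block factor coincide. [folklore] -/
theorem withDensity_chartWeightSU_expJac_eq (S : ℝ) (R' : BlockChartSU N Λ → ℝ≥0∞) :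
    ((volume : Measure (BlockChartSU N Λ)).withDensity fun x =>
        chartWeightSU Λ S (expJacWeightSU (kappaSU N)) x * R' x) =
      (volume : Measure (BlockChartSU N Λ)).withDensity fun x =>
        chartWeightSU Λ S (fun v => kappaSU N * jacM v) x * R' x :=
  withDensity_congr_ae ((chartWeightSU_expJac_ae_eq Λ S).mono fun x hx => by
    show chartWeightSU Λ S (expJacWeightSU (kappaSU N)) x * R' x = _; rw [hx])

end Jacobian

/-! ## §4 Member (λ) for `G = SU(N)`, REALIZED, with (C-ii) on the block weight alone -/

section Realized

open ShellMeasureExpJacobianSUN (expJacWeightSU measurable_expJacWeightSU)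
open ShellMeasureExpHaarAreaSUN (jacM measurable_jacM kappaSU)
open ShellMeasureExpHaarClosedBallSUN (haar_restrict_expBallSU_le)
open ShellMeasureExpChartSUN (measurable_chartWeightSU measurable_expFibreChartSU mem_closedBall_of_chartWeightSU_ne_zero)
open ShellMeasureScalingSUN (windowSU measurable_windowSU chart_suN)
open ShellMeasureRootCompositionSUN (slotAC_realized_suN_of_chartAC)
open ShellMeasureLogConcaveJacobianSUN (isLogConcaveWeight_chartWeightSU_smul_jacM)
open T4ShellMeasureDet (blockLaw measurable_section withDensity_eq_map_chart)
open GaugeField (GaugeInvariant)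
open T4TreeGaugeFixing (NoClosedLoop fixTo measurable_fixTo)
open ShellMeasureScalingLocal (slotAntiConcentration_gaugeFixed_iff)

variable {N : ℕ} [NeZero N] {P : Params} {j : ℕ} [DecidableEq (PBond P j)]

/-- **MEMBER (λ) FOR `G = SU(N)`, EVERY `N`, REALIZED — NO CHART-SIDE BINDER, (C-ii) ON THE BLOCK WEIGHT ALONE.**  The
`SU(N)` twin of `ShellMeasureLogConcaveJacobian.slotAntiConcentration_realized_su2_of_logConcave_blockWeight`.  Data:
the bonds `Λ` of the slot's block (block chart space `BlockChartSU N Λ = Λ → ℝ^{d_N}`); a window radius `0 ≤ S ≤ π`; for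
every exterior `V` a chart centre `c V` and a measurable block weight `R V`; the realized density `F` with the window
factorisation `F(V[Λ := y]) = windowSU Λ (c V) S y · R V y` (`hFw`); per-section finiteness `hfin`; the tested variable
`u`; numbers `θ > 0`, `0 ≤ ρ ≤ 1/2`, `P ≥ 0`.  HYPOTHESES per `V`, in the chart `κ = expFibreChartSU Λ (c V)`:
(C-ii) `hlcR` — the windowed block weight ALONE, `x ↦ 1_{‖x‖≤S}(x)·R V(κ x)`, is a LOG-CONCAVE weight (the Haar
Jacobian `1_{‖x‖≤S}·∏_b κ_N·J(x_b)` rides free: `ShellMeasureLogConcaveJacobianSUN.isLogConcaveWeight_chartWeightSU_smul_jacM`);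
(C-i) `hconv` — `x ↦ u(V[Λ := κ x])` is convex on the support of that weight; (C-iii) `hhalf` — the block section law
has total mass `≤ e^P ×` its mass on `{u < θ/2}`.  CONCLUSION: (M1)
`SlotAntiConcentration ((fieldMeasure P j SU(N)).withDensity F) u θ ρ (2P)` — no `#Λ·d_N`, no `B_f`, no depth.
Assembly: E2N `ShellMeasureRootCompositionSUN.slotAC_realized_suN_of_chartAC` ((CH)₁ a THEOREM,
`ShellMeasureExpHaarClosedBallSUN.haar_restrict_expBallSU_le`) ∘ the a.e. Jacobian swap of §3 ∘ the transported engine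
`slotAntiConcentration_of_logConcave_blockChartSU` of §2. [folklore] -/
theorem slotAntiConcentration_realized_suN_of_logConcave_blockWeight (Λ : Finset (PBond P j)) {S : ℝ} (hS : 0 ≤ S)
    (hSπ : S ≤ Real.pi) (c : GaugeField P j (SUN N) → GaugeField P j (SUN N))
    {R : GaugeField P j (SUN N) → (↥Λ → SUN N) → ℝ≥0∞} (hR : ∀ V, Measurable (R V))
    {F : GaugeField P j (SUN N) → ℝ≥0∞} (hF : Measurable F)
    (hFw : ∀ V y, F (updateFinset V Λ y) = windowSU Λ (c V) S y * R V y)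
    (hfin : ∀ V, ((blockLaw Λ).withDensity fun y => F (updateFinset V Λ y)) univ ≠ ∞)
    {u : GaugeField P j (SUN N) → ℝ} (hu : Measurable u) {θ ρ Pm : ℝ} (hθ : 0 < θ) (hρ0 : 0 ≤ ρ) (hρ : ρ ≤ 1 / 2) (hPm : 0 ≤ Pm)
    (hlcR : ∀ V, IsLogConcaveWeight fun x : BlockChartSU N Λ =>
      (closedBall (0 : BlockChartSU N Λ) S).indicator (fun x => R V (expFibreChartSU Λ (c V) x)) x)
    (hconv : ∀ V, ConvexOnSupport
      (fun x : BlockChartSU N Λ => (closedBall (0 : BlockChartSU N Λ) S).indicator (fun x => R V (expFibreChartSU Λ (c V) x)) x)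
      (fun x => u (updateFinset V Λ (expFibreChartSU Λ (c V) x))))
    (hhalf : ∀ V, ((blockLaw Λ).withDensity fun y => F (updateFinset V Λ y)) univ ≤
      ENNReal.ofReal (Real.exp Pm) *
        ((blockLaw Λ).withDensity fun y => F (updateFinset V Λ y)) {y | u (updateFinset V Λ y) < θ / 2}) :
    SlotAntiConcentration ((fieldMeasure P j (SUN N)).withDensity F) u θ ρ (2 * Pm) := by
  refine slotAC_realized_suN_of_chartAC Λ hS hSπ c hR hF hFw hu fun V => ?_
  have hκ : Measurable (expFibreChartSU Λ (c V)) := measurable_expFibreChartSU Λ (c V)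
  have hJ : Measurable (expJacWeightSU (N := N) (kappaSU N)) := measurable_expJacWeightSU (kappaSU N)
  have huV : Measurable fun y => u (updateFinset V Λ y) := measurable_section Λ hu V
  have hsecF : (fun y => F (updateFinset V Λ y)) = fun y => windowSU Λ (c V) S y * R V y := funext (hFw V)
  have hfinV := hfin V; have hhalfV := hhalf V; rw [hsecF] at hfinV hhalfV
  -- the chart identity of record transports the two masses of (C-iii) and the finiteness to the chart side
  have hident := withDensity_eq_map_chart (blockLaw Λ) volume hκ (measurable_chartWeightSU Λ S hJ)
    (measurable_windowSU Λ (c V) S) (chart_suN Λ (c V) hS hJ (haar_restrict_expBallSU_le hSπ)) (hR V)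
  have hpre : ∀ s : Set (↥Λ → SUN N), MeasurableSet s →
      ((volume : Measure (BlockChartSU N Λ)).withDensity fun x =>
          chartWeightSU Λ S (expJacWeightSU (kappaSU N)) x * R V (expFibreChartSU Λ (c V) x))
          (expFibreChartSU Λ (c V) ⁻¹' s) =
        ((blockLaw Λ).withDensity fun y => windowSU Λ (c V) S y * R V y) s := by
    intro s hs; rw [hident, Measure.map_apply hκ hs]
  have huniv := hpre univ MeasurableSet.univ; rw [preimage_univ] at huniv
  have hlev := hpre {y | u (updateFinset V Λ y) < θ / 2} (measurableSet_lt huV measurable_const)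
  -- swap the Jacobian of record for its continuous, log-concave representative (same law)
  rw [withDensity_chartWeightSU_expJac_eq Λ S] at huniv hlev ⊢
  -- the chart-side weight with the continuous Jacobian: measurable, log-concave, classifier convex on its support
  have hJm : Measurable fun v : ChartSU N => kappaSU N * jacM v := measurable_const.mul measurable_jacM
  have hwm : Measurable fun x : BlockChartSU N Λ =>
      chartWeightSU Λ S (fun v => kappaSU N * jacM v) x * R V (expFibreChartSU Λ (c V) x) :=
    (measurable_chartWeightSU Λ S hJm).mul ((hR V).comp hκ)
  have heq : (fun x : BlockChartSU N Λ =>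
      chartWeightSU Λ S (fun v => kappaSU N * jacM v) x *
        (closedBall (0 : BlockChartSU N Λ) S).indicator (fun x => R V (expFibreChartSU Λ (c V) x)) x) =
      fun x => chartWeightSU Λ S (fun v => kappaSU N * jacM v) x * R V (expFibreChartSU Λ (c V) x) := by
    funext x
    by_cases hx : x ∈ closedBall (0 : BlockChartSU N Λ) S
    · rw [indicator_of_mem hx]
    · have h0 : chartWeightSU Λ S (fun v => kappaSU N * jacM v) x = 0 := by
        by_contra h0; exact hx (mem_closedBall_of_chartWeightSU_ne_zero Λ h0)
      rw [h0, zero_mul, zero_mul]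
  have hlc : IsLogConcaveWeight fun x : BlockChartSU N Λ =>
      chartWeightSU Λ S (fun v => kappaSU N * jacM v) x * R V (expFibreChartSU Λ (c V) x) := by
    have h := isLogConcaveWeight_mul (isLogConcaveWeight_chartWeightSU_smul_jacM Λ (kappaSU N) hS hSπ) (hlcR V)
    rwa [heq] at h
  have hcv : ConvexOnSupport
      (fun x : BlockChartSU N Λ => chartWeightSU Λ S (fun v => kappaSU N * jacM v) x * R V (expFibreChartSU Λ (c V) x))
      (fun x => u (updateFinset V Λ (expFibreChartSU Λ (c V) x))) := by
    intro x y hx hy s hs0 hs1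
    have hx' := mul_ne_zero_iff.mp hx; have hy' := mul_ne_zero_iff.mp hy
    refine hconv V x y ?_ ?_ hs0 hs1
    · show (closedBall (0 : BlockChartSU N Λ) S).indicator (fun x => R V (expFibreChartSU Λ (c V) x)) x ≠ 0
      rw [indicator_of_mem (mem_closedBall_of_chartWeightSU_ne_zero Λ hx'.1)]; exact hx'.2
    · show (closedBall (0 : BlockChartSU N Λ) S).indicator (fun x => R V (expFibreChartSU Λ (c V) x)) y ≠ 0
      rw [indicator_of_mem (mem_closedBall_of_chartWeightSU_ne_zero Λ hy'.1)]; exact hy'.2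
  refine slotAntiConcentration_of_logConcave_blockChartSU Λ hwm hlc (by rw [huniv]; exact hfinV) (huV.comp hκ) hcv
    hθ hρ0 hρ hPm ?_
  rw [huniv]; refine hhalfV.trans (le_of_eq ?_); rw [← hlev]; rfl

/-- **… FOR A GAUGE-INVARIANT PAIR, THROUGH THE TREE GAUGE (`G = SU(N)`).**  `T` loop-free, any prescribed values `U₀`;
the window factorisation, the finiteness and (C-i)/(C-ii)/(C-iii) are asked of the TREE-GAUGED sections
`V ↦ (F ∘ fixTo T U₀)(V[Λ := y])`, `u ∘ fixTo T U₀` (`ShellMeasureScalingLocal.slotAntiConcentration_gaugeFixed_iff`), as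
E2N's `slotAC_realized_suN_of_chartAC_gauge` arranges it for the engine of record. [folklore] -/
theorem slotAntiConcentration_realized_suN_of_logConcave_blockWeight_gauge {T : Finset (PBond P j)} (hT : NoClosedLoop T)
    (U₀ : GaugeField P j (SUN N)) (Λ : Finset (PBond P j)) {S : ℝ} (hS : 0 ≤ S) (hSπ : S ≤ Real.pi)
    (c : GaugeField P j (SUN N) → GaugeField P j (SUN N))
    {R : GaugeField P j (SUN N) → (↥Λ → SUN N) → ℝ≥0∞} (hR : ∀ V, Measurable (R V))
    {F : GaugeField P j (SUN N) → ℝ≥0∞} (hF : Measurable F) (hFi : GaugeInvariant F)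
    (hFw : ∀ V y, F (fixTo T U₀ (updateFinset V Λ y)) = windowSU Λ (c V) S y * R V y)
    (hfin : ∀ V, ((blockLaw Λ).withDensity fun y => F (fixTo T U₀ (updateFinset V Λ y))) univ ≠ ∞)
    {u : GaugeField P j (SUN N) → ℝ} (hu : Measurable u) (hui : GaugeInvariant u) {θ ρ Pm : ℝ} (hθ : 0 < θ) (hρ0 : 0 ≤ ρ)
    (hρ : ρ ≤ 1 / 2) (hPm : 0 ≤ Pm)
    (hlcR : ∀ V, IsLogConcaveWeight fun x : BlockChartSU N Λ =>
      (closedBall (0 : BlockChartSU N Λ) S).indicator (fun x => R V (expFibreChartSU Λ (c V) x)) x)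
    (hconv : ∀ V, ConvexOnSupport
      (fun x : BlockChartSU N Λ => (closedBall (0 : BlockChartSU N Λ) S).indicator (fun x => R V (expFibreChartSU Λ (c V) x)) x)
      (fun x => u (fixTo T U₀ (updateFinset V Λ (expFibreChartSU Λ (c V) x)))))
    (hhalf : ∀ V, ((blockLaw Λ).withDensity fun y => F (fixTo T U₀ (updateFinset V Λ y))) univ ≤
      ENNReal.ofReal (Real.exp Pm) *
        ((blockLaw Λ).withDensity fun y => F (fixTo T U₀ (updateFinset V Λ y))) {y | u (fixTo T U₀ (updateFinset V Λ y)) < θ / 2}) :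
    SlotAntiConcentration ((fieldMeasure P j (SUN N)).withDensity F) u θ ρ (2 * Pm) :=
  (slotAntiConcentration_gaugeFixed_iff hT U₀ hF hFi hu hui).1
    (slotAntiConcentration_realized_suN_of_logConcave_blockWeight Λ hS hSπ c hR (hF.comp (measurable_fixTo T U₀)) hFw
      hfin (hu.comp (measurable_fixTo T U₀)) hθ hρ0 hρ hPm hlcR hconv hhalf)

end Realized

end Summit.QuantumFields.BalabanUV.T4Continuum.ShellMeasureLogConcaveSUN

end
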